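import Summits.NavierStokesRegularity.NavierStokesRegularity.Theorems.HodographBetchovFastClassSqueezeGerm
import Summits.NavierStokesRegularity.NavierStokesRegularity.Theorems.HodographBetchovFastClassSqueezeWeylSplitTransfer
import Summits.NavierStokesRegularity.NavierStokesRegularity.Theorems.HodographBetchovFastClassSqueezeStubPointSqueezeOfSubscale
import Summits.NavierStokesRegularity.NavierStokesRegularity.Theorems.HodographBetchovFastClassSqueezeStubGermOfPointSqueeze
import Literature.Analysis.FluidPDE.LerayGaugeStrainSpectrum

/-!
# Line skeleton for crux `FastClassSqueeze` — line `Sketch-ideasK1` (idea B: resolved-weyl-split, at the germs of Σ_T)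

Crux (verbatim `Summit.NavierStokesRegularity.NavierStokesRegularity.Theses.HodographBetchov.FastClassSqueeze`,
item stmt-NavierStokesRegularity-15832): along every classical solution `(u,p)` of unforced Navier–Stokes on
`ℝ³ × [0,T)` that is Leray–Hopf from a rapidly decaying datum there are `l > 0`, `q > 3/2` and a nonnegative
min–max majorant `m` of the middle principal strain on the fast class `F_l(t) = {x : l < |u(t,x)|}` with
`∫₀ᵀ (∫_{F_l(t)} m^q)^{2/(2q−3)} dt < ∞`.

## The line

LANDED ingredients (prover seat 0 of the route): the crux follows from GERM data near the compact top singular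
set `Σ_T(u) = {x | (T,x) is a backward singular point}` (`Germ.fastClassSqueeze_of_germSqueeze`,
`Germ.isCompact_topSingularSet`, p157947); the RESOLVED gradient `A_R = ⨍_{B̄_R(x)} ∇u(t)` is a-priori
Miller-finite on the fast class for `q ≥ 3` (`WeylSplit.resolved_rpow_le`, B2, p155437) and a plane bound for
`∇u − A_R` is a plane bound for `∇u` up to `‖A_R‖` (`WeylSplit.plane_form_le_add_opNorm`, p156017); the
min–max clause is `λ₂(sym ∇u) ≤ m` (`strainEigenvalues_mid_le_iff`, p154274).  Writing
`λ₂(A) := strainEigenvalues (A : ℝ³ →ₗ ℝ³) _ 1` (middle principal strain, `ENNReal.ofReal` clips it at 0):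

* `stub_pointSubscaleSqueeze` — **OPEN, the hard core (card: LocalSubscaleSqueeze).** For every flow of the
  crux there is an exponent `q ≥ 3` such that at every backward-singular point `(T,x₀)` some parabolic germ
  `(τ,T) × B_r(x₀)`, level `l > 0` and resolution `R > 0` carry a finite Miller functional of the SUBSCALE
  middle strain of the fast fluid: `∫_τ^T (∫_{F_l(t) ∩ B_r(x₀)} (λ₂(∇u − A_R)⁺)^q dx)^{2/(2q−3)} dt < ∞`.
  (Regularity-strength: a self-similar-rate collapse at `x₀` whose profile has `λ₂⁺ ≢ 0` on fast fluid makes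
  it log-divergent; rank-one rigidity `λ₂(sym(a ⊗ b)) = 0` says only rank-≥2 subscale straining of FAST fluid
  at `x₀` is charged.)
* `stub_pointSqueeze_of_subscale` — **LANDED p161584 (local B1 + B2).** On one germ, finiteness of the subscale
  functional implies finiteness of the full one (`λ₂(∇u) ≤ λ₂(∇u − A_R) + ‖A_R‖` by Courant–Fischer/Weyl,
  `(a+b)^q ≤ 2^{q−1}(a^q+b^q)`, `(X+Y)^{2/(2q−3)} ≤ X^{2/(2q−3)} + Y^{2/(2q−3)}` for `q ≥ 3`, and B2 restricted
  to the ball; measurability of the resolved half as in `WeylSplit.fastClassSqueeze_of_subscaleSqueeze`).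
* `stub_germ_of_pointSqueeze` — **LANDED p162360 (cover glue).** Point squeezes with a COMMON exponent `q > 3/2` at
  every point of the compact `Σ_T(u)` give germ data on a neighbourhood `U ⊇ Σ_T(u)`: finite subcover by the
  balls `B_{r_i}(x_i)`, `U = ⋃ B_{r_i}(x_i)`, `τ = max τ_i`, `l = max l_i`, `m = λ₂(∇u)⁺` (admissible by
  Courant–Fischer), `∫_{F_l ∩ U} ≤ Σ_i ∫_{F_{l_i} ∩ B_i}` and `(Σ_{i<N} a_i)^e ≤ N^e Σ_i a_i^e`; the time
  integral splits because `t ↦ ∫_{F_l(t) ∩ B} (λ₂⁺)^q` is measurable (joint continuity of `∇u`, continuity of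
  `λ₂`, openness of the space–time fast set).

Assembly `FastClassSqueeze_of`: stub 1 gives `q` and the subscale germs; stub 2 turns each into a full point
squeeze; stub 3 glues them over `Σ_T(u)`; `Germ.fastClassSqueeze_of_germSqueeze` concludes the crux BY NAME.
A direct proof of the plain point squeeze (any `q > 3/2`) closes the crux through stub 3 alone.

Disproof used: no `Disproof.lean` exists for this crux yet; the landed Negative lemma
`FastClassSqueeze.Negative.fastClassSqueeze_false_without_lerayHopf` (biaxial strain from rest: `∇u` spatially
constant, so `∇u − A_R ≡ 0` and stub 1 HOLDS for the witness while the crux fails) is honoured: the energy class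
is used in stub 2 (B2: `|F_l| ≤ 2E₀/l²`, `ν∫∫|∇u|² ≤ E₀`) and in stub 3 / the Germ transfer (far-field bound,
compactness of `Σ_T`), i.e. "the line uses H = IsLerayHopfOn at stub_pointSqueeze_of_subscale and at the cover".
-/

noncomputable section

-- the summit and its single problem share the name `NavierStokesRegularity` (D-0017 nested layout)
set_option linter.dupNamespace false

namespace Summit.NavierStokesRegularity.NavierStokesRegularity.Cruxes.FastClassSqueeze.GermWeyl

open Set MeasureTheory Metric Literature.Analysis.FluidPDE
open scoped ENNReal

/-- **Stub 1 — point subscale squeeze at the top singular set (OPEN, the hard core).** Along every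
classical solution of unforced Navier–Stokes on `ℝ³ × [0,T)` that is Leray–Hopf from a rapidly decaying datum
there is an exponent `q ≥ 3` such that at every backward-singular point `(T, x₀)` some germ `(τ,T) × B_r(x₀)`
(`0 ≤ τ < T`), level `l > 0` and resolution `R > 0` carry a finite Miller functional (`2/p + 3/q = 2`) of the subscale middle
principal strain `λ₂(∇u(t,x) − ⨍_{B̄_R(x)} ∇u(t))⁺` of the fast fluid `{l < |u(t,x)|}`. -/
theorem stub_pointSubscaleSqueeze :
    ∀ (ν T : ℝ), 0 < ν → 0 < T →
      ∀ (u : ℝ → EuclideanSpace ℝ (Fin 3) → EuclideanSpace ℝ (Fin 3)) (p : ℝ → EuclideanSpace ℝ (Fin 3) → ℝ),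
      Literature.Analysis.FluidPDE.IsClassicalNSSolutionOn (Set.Ico 0 T) ν 0 u p →
      Literature.Analysis.FluidPDE.IsLerayHopfOn T ν 0 (u 0) u →
      Literature.Analysis.FluidPDE.HasRapidSpatialDecay (u 0) →
      ∃ q : ℝ, 3 ≤ q ∧ ∀ x₀ : EuclideanSpace ℝ (Fin 3),
        Literature.Analysis.FluidPDE.IsBackwardSingularPoint u (T, x₀) →
        ∃ r : ℝ, 0 < r ∧ ∃ R : ℝ, 0 < R ∧ ∃ τ : ℝ, 0 ≤ τ ∧ τ < T ∧ ∃ l : ℝ, 0 < l ∧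
          ∫⁻ t in Set.Ioo τ T, (∫⁻ x in {x : EuclideanSpace ℝ (Fin 3) | l < ‖u t x‖} ∩ Metric.ball x₀ r,
            ENNReal.ofReal (Literature.Analysis.FluidPDE.strainEigenvalues
              ((fderiv ℝ (u t) x - ⨍ y in Metric.closedBall x R, fderiv ℝ (u t) y :
                  EuclideanSpace ℝ (Fin 3) →L[ℝ] EuclideanSpace ℝ (Fin 3)) :
                EuclideanSpace ℝ (Fin 3) →ₗ[ℝ] EuclideanSpace ℝ (Fin 3))
              finrank_euclideanSpace_fin 1) ^ q) ^ (2 / (2 * q - 3)) < ⊤ := by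
  sorry

/-- **Stub 2 — local Weyl assembly on one germ (provable: B1 + B2 restricted to a ball).** For a flow of
the crux, a centre `x₀`, radius `r`, resolution `R`, time `τ ≥ 0`, level `l > 0` and exponent `q ≥ 3`: if the
subscale middle strain `λ₂(∇u − A_R)⁺` of the fast fluid has a finite Miller functional on `(τ,T) × B_r(x₀)`,
so has the full middle strain `λ₂(∇u)⁺` (`λ₂(∇u) ≤ λ₂(∇u − A_R) + ‖A_R‖` and the resolved gradient is
a-priori Miller-finite for `q ≥ 3`, `WeylSplit.resolved_rpow_le`). -/
theorem stub_pointSqueeze_of_subscale :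
    ∀ (ν T : ℝ), 0 < ν → 0 < T →
      ∀ (u : ℝ → EuclideanSpace ℝ (Fin 3) → EuclideanSpace ℝ (Fin 3)) (p : ℝ → EuclideanSpace ℝ (Fin 3) → ℝ),
      Literature.Analysis.FluidPDE.IsClassicalNSSolutionOn (Set.Ico 0 T) ν 0 u p →
      Literature.Analysis.FluidPDE.IsLerayHopfOn T ν 0 (u 0) u →
      ∀ (x₀ : EuclideanSpace ℝ (Fin 3)) (r R τ l q : ℝ), 0 ≤ τ → 0 < l → 3 ≤ q →
        ∫⁻ t in Set.Ioo τ T, (∫⁻ x in {x : EuclideanSpace ℝ (Fin 3) | l < ‖u t x‖} ∩ Metric.ball x₀ r,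
            ENNReal.ofReal (Literature.Analysis.FluidPDE.strainEigenvalues
              ((fderiv ℝ (u t) x - ⨍ y in Metric.closedBall x R, fderiv ℝ (u t) y :
                  EuclideanSpace ℝ (Fin 3) →L[ℝ] EuclideanSpace ℝ (Fin 3)) :
                EuclideanSpace ℝ (Fin 3) →ₗ[ℝ] EuclideanSpace ℝ (Fin 3))
              finrank_euclideanSpace_fin 1) ^ q) ^ (2 / (2 * q - 3)) < ⊤ →
        ∫⁻ t in Set.Ioo τ T, (∫⁻ x in {x : EuclideanSpace ℝ (Fin 3) | l < ‖u t x‖} ∩ Metric.ball x₀ r,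
            ENNReal.ofReal (Literature.Analysis.FluidPDE.strainEigenvalues
              ((fderiv ℝ (u t) x : EuclideanSpace ℝ (Fin 3) →L[ℝ] EuclideanSpace ℝ (Fin 3)) :
                EuclideanSpace ℝ (Fin 3) →ₗ[ℝ] EuclideanSpace ℝ (Fin 3))
              finrank_euclideanSpace_fin 1) ^ q) ^ (2 / (2 * q - 3)) < ⊤ :=
  -- LANDED p161584 (worker A): Theorems/HodographBetchovFastClassSqueezeStubPointSqueezeOfSubscale.lean
  Theorems.FastClassSqueeze.GermWeyl.stub_pointSqueeze_of_subscale

/-- **Stub 3 — cover glue over the compact top singular set (provable).** For a flow of the crux and an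
exponent `q > 3/2`: if at every backward-singular point `(T, x₀)` some germ `(τ,T) × B_r(x₀)` (`0 ≤ τ < T`) and
level `l` carry a finite Miller functional of the middle principal strain `λ₂(∇u)⁺` of the fast fluid, then there are an
open `U ⊇ Σ_T(u)`, a time `τ < T`, a level `l` and a nonnegative min–max majorant `m` on the fast points of
`(τ,T) × U` with `∫_τ^T (∫_{F_l(t) ∩ U} m^q)^{2/(2q−3)} < ∞` — the hypothesis of
`Germ.fastClassSqueeze_of_germSqueeze` (finite subcover of the compact `Σ_T(u)`, `m = λ₂(∇u)⁺`). -/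
theorem stub_germ_of_pointSqueeze :
    ∀ (ν T : ℝ), 0 < ν → 0 < T →
      ∀ (u : ℝ → EuclideanSpace ℝ (Fin 3) → EuclideanSpace ℝ (Fin 3)) (p : ℝ → EuclideanSpace ℝ (Fin 3) → ℝ),
      Literature.Analysis.FluidPDE.IsClassicalNSSolutionOn (Set.Ico 0 T) ν 0 u p →
      Literature.Analysis.FluidPDE.IsLerayHopfOn T ν 0 (u 0) u →
      Literature.Analysis.FluidPDE.HasRapidSpatialDecay (u 0) →
      ∀ q : ℝ, 3 / 2 < q →
        (∀ x₀ : EuclideanSpace ℝ (Fin 3), Literature.Analysis.FluidPDE.IsBackwardSingularPoint u (T, x₀) →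
          ∃ r : ℝ, 0 < r ∧ ∃ τ : ℝ, 0 ≤ τ ∧ τ < T ∧ ∃ l : ℝ,
            ∫⁻ t in Set.Ioo τ T, (∫⁻ x in {x : EuclideanSpace ℝ (Fin 3) | l < ‖u t x‖} ∩ Metric.ball x₀ r,
              ENNReal.ofReal (Literature.Analysis.FluidPDE.strainEigenvalues
                ((fderiv ℝ (u t) x : EuclideanSpace ℝ (Fin 3) →L[ℝ] EuclideanSpace ℝ (Fin 3)) :
                  EuclideanSpace ℝ (Fin 3) →ₗ[ℝ] EuclideanSpace ℝ (Fin 3))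
                finrank_euclideanSpace_fin 1) ^ q) ^ (2 / (2 * q - 3)) < ⊤) →
        ∃ U : Set (EuclideanSpace ℝ (Fin 3)), IsOpen U ∧
          {x : EuclideanSpace ℝ (Fin 3) | Literature.Analysis.FluidPDE.IsBackwardSingularPoint u (T, x)} ⊆ U ∧
          ∃ τ : ℝ, τ < T ∧ ∃ l : ℝ, ∃ m : ℝ → EuclideanSpace ℝ (Fin 3) → ℝ,
            (∀ t x, 0 ≤ m t x) ∧
            (∀ t ∈ Set.Ico 0 T, τ < t → ∀ x ∈ U, l < ‖u t x‖ →
              ∃ v w : EuclideanSpace ℝ (Fin 3), ‖v‖ = 1 ∧ ‖w‖ = 1 ∧ inner ℝ v w = 0 ∧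
                ∀ α β : ℝ, inner ℝ (fderiv ℝ (u t) x (α • v + β • w)) (α • v + β • w) ≤
                  m t x * (α ^ 2 + β ^ 2)) ∧
            ∫⁻ t in Set.Ioo τ T, (∫⁻ x in {x : EuclideanSpace ℝ (Fin 3) | l < ‖u t x‖} ∩ U,
              ENNReal.ofReal (m t x) ^ q) ^ (2 / (2 * q - 3)) < ⊤ :=
  -- LANDED p162360 (worker B): Theorems/HodographBetchovFastClassSqueezeStubGermOfPointSqueeze.lean
  Theorems.FastClassSqueeze.GermWeyl.stub_germ_of_pointSqueeze

/-- **Assembly: the crux BY NAME from the three registered stubs BY NAME** (kernel-checked; no `sorry`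
outside the stubs).  Stub 1 supplies a common exponent `q ≥ 3` and, at every top singular point, a germ with
finite subscale functional; stub 2 upgrades each to a finite full middle-strain functional; stub 3 glues the
germs over the compact `Σ_T(u)` into the hypothesis of `Germ.fastClassSqueeze_of_germSqueeze`. -/
theorem FastClassSqueeze_of :
    Summit.NavierStokesRegularity.NavierStokesRegularity.Theses.HodographBetchov.FastClassSqueeze := by
  refine Theorems.FastClassSqueeze.Germ.fastClassSqueeze_of_germSqueeze ?_
  intro ν T hν hT u p hcl hLH hdec
  obtain ⟨q, hq3, hpt⟩ := stub_pointSubscaleSqueeze ν T hν hT u p hcl hLH hdec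
  have hq : 3 / 2 < q := by linarith
  have hfull : ∀ x₀ : EuclideanSpace ℝ (Fin 3),
      Literature.Analysis.FluidPDE.IsBackwardSingularPoint u (T, x₀) →
      ∃ r : ℝ, 0 < r ∧ ∃ τ : ℝ, 0 ≤ τ ∧ τ < T ∧ ∃ l : ℝ,
        ∫⁻ t in Set.Ioo τ T, (∫⁻ x in {x : EuclideanSpace ℝ (Fin 3) | l < ‖u t x‖} ∩ Metric.ball x₀ r,
          ENNReal.ofReal (Literature.Analysis.FluidPDE.strainEigenvalues
            ((fderiv ℝ (u t) x : EuclideanSpace ℝ (Fin 3) →L[ℝ] EuclideanSpace ℝ (Fin 3)) :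
              EuclideanSpace ℝ (Fin 3) →ₗ[ℝ] EuclideanSpace ℝ (Fin 3))
            finrank_euclideanSpace_fin 1) ^ q) ^ (2 / (2 * q - 3)) < ⊤ := by
    intro x₀ hx₀
    obtain ⟨r, hr, R, -, τ, hτ0, hτ, l, hl, hint⟩ := hpt x₀ hx₀
    exact ⟨r, hr, τ, hτ0, hτ, l,
      stub_pointSqueeze_of_subscale ν T hν hT u p hcl hLH x₀ r R τ l q hτ0 hl hq3 hint⟩
  obtain ⟨U, hU, hSU, τ, hτ, l, m, hm0, hclause, hint⟩ :=
    stub_germ_of_pointSqueeze ν T hν hT u p hcl hLH hdec q hq hfull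
  exact ⟨U, hU, hSU, τ, hτ, l, q, hq, m, hm0, hclause, hint⟩

end Summit.NavierStokesRegularity.NavierStokesRegularity.Cruxes.FastClassSqueeze.GermWeyl

end
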